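import Mathlib
import HarnessLib
import Summits.CriticalPhenomena.PercolationContinuityZ3.Theses.PercLowPointHalfSpace
import Summits.CriticalPhenomena.PercolationContinuityZ3.Theorems.PercLowPointHalfSpaceLowPointBookkeepingPointToWall
import Summits.CriticalPhenomena.PercolationContinuityZ3.Theorems.PercLowPointHalfSpaceAssemblyWallExit
import Summits.CriticalPhenomena.PercolationContinuityZ3.Theorems.PercLowPointHalfSpaceAssemblyReduction
import Literature.Probability.Percolation.ConnectivityProofs
import Literature.Probability.Percolation.SiteConnectionTools
import Literature.Probability.Percolation.ContinuityCriterion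

/-!
# Crux `LowPointBookkeeping` (stmt-CriticalPhenomena-14713): the level-count form of the crux

Helper file for the crux item `stmt-CriticalPhenomena-14713` (`LowPointBookkeeping`, K) of route
`CriticalPhenomena/PercLowPointHalfSpace` (lands `--supports stmt-CriticalPhenomena-14713`, registered
stub `stub_levelCountForm`; line `SketchIdeator1`, lead c4).  With the point-to-wall identity
`P_p(h e₀ ↔ ∂ℍ in ℍ) = E_p[N_h(U)/|U ∩ ∂ℍ|]` of
`PercLowPointHalfSpaceLowPointBookkeepingPointToWall.lean` (`U = C_ℍ(0)` the wall cluster of the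
origin, `N_h(U) = |U ∩ {x₀ = h}|`, `|U ∩ ∂ℍ|` its footprint):

* `LowPoint.exists_wallConn_of_percolatesAt` (deterministic): an infinite open cluster at `h e₀`
  reaches the floor inside `ℍ` once all half-space clusters are finite;
* `LowPoint.theta_le_real_wallConn`, `LowPoint.theta_le_lintegral_levelCount`:
  `θ(p) ≤ P_p(h e₀ ↔ ∂ℍ in ℍ) = E_p[N_h(U)/|U ∩ ∂ℍ|]` for `p ≤ p_c(ℤ³)` and every `h`
  (Barsky–Grimmett–Newman + translation invariance);
* `LowPoint.real_wallConn_le_real_siteToBoundary`, `LowPoint.tendsto_real_wallConn_of_percolationContinuityZ3`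
  (converse): `{h e₀ ↔ ∂ℍ in ℍ}` is a one-arm event to distance `h`, so it decays if `θ(p_c) = 0`;
* `LowPoint.percolationContinuityZ3_iff_tendsto_levelCount`:
  **`θ(p_c(ℤ³)) = 0 ⟺ E_{p_c}[N_h(U)/|U ∩ ∂ℍ|] → 0`**;
* `LowPoint.lowPointBookkeeping_iff_levelCount` = `stub_levelCountForm`:
  **K ⟺ (A → B → C → `E_{p_c}[N_h(U)/|U ∩ ∂ℍ|] → 0`)**, and the sufficient direction
  `lowPointBookkeeping_of_tendsto_levelCount`.

So the open content of K is exactly: from A (adjacent-root disjoint two-arm exponent `5/2 + κ`),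
B (rooted first moment of `|U ∩ B_r|` on the `r`-arm event, `≤ C r^{11/4} π_s(r)`) and C
(`π_s(r) ≤ C r^{-a}` for some `a > 0`) show that the footprint-normalised level-`h` mass of the wall
cluster vanishes.  B and C bound only the near part, `E[N_h(U)·𝟙{offset ≤ h}] ≤ C h^{11/4} π_s(h) ≤
C h^{11/4-a}` with `a ≤ 2` — never small — and say nothing about far offsets or the footprint; this is
the pair-free form of the reason why the line's two open stubs (A♯ₛ, B♯) are hypothesis-level
(`Cruxes/LowPointBookkeeping/Lines/SketchIdeator1.dead.md`).

Sources: G. Grimmett, *Percolation* (1999), Thm. (7.35), §1.4 (`θ(p) = lim P_p(0 ↔ ∂B(n))`), §8.5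
(`τ ≥ θ²`); R. Lyons – Y. Peres, *Probability on Trees and Networks* (2016), §8.2.
-/


noncomputable section

namespace Summit.CriticalPhenomena.PercolationContinuityZ3.Theorems

open MeasureTheory Filter Topology
open Literature.Probability.Percolation Literature.Probability.LatticeModels
open Summit.CriticalPhenomena.PercolationContinuityZ3.Theses.PercLowPointHalfSpace
open scoped ENNReal

namespace LowPoint

/-- The shift `ω ↦ ω + s` of bond configurations of `ℤ³` (local notation). -/
local notation3 (prettyPrint := false) "𝑻[" s "]" => BondConfig.relabel (sym2Equiv (Site.shift s))

/-- The point `h e₀ = (h, 0, 0)` on the normal axis (local notation). -/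
local notation3 (prettyPrint := false) "𝐏[" h "]" => (Pi.single 0 ((h : ℕ) : ℤ) : Site 3)

/-- The `ℍ`-cluster `C_ℍ(a) = {u | a ↔ u in ℍ}` of a vertex `a` (local notation). -/
local notation3 (prettyPrint := false) "𝐜𝐥[" ω ", " a "]" =>
  ({u : Site 3 | ω ∈ openConnIn (halfSpace 3) a u} : Set (Site 3))

/-! ## Deterministic part: the wall connection of an infinite cluster -/

section Deterministic


/-- A lattice neighbour of a vertex at height `≥ 1` lies in `ℍ`. [folklore] -/
theorem neighbour_mem_halfSpace {a b : Site 3} (hab : (zdGraph 3).Adj a b) (ha : 1 ≤ a 0) :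
    b ∈ halfSpace 3 := by
  show (0 : ℤ) ≤ b 0
  obtain ⟨i, h | h⟩ := (zdGraph_adj_iff a b).1 hab
  · have : b 0 = a 0 + (Pi.single i (1 : ℤ) : Site 3) 0 := by rw [h, Pi.add_apply]
    rw [this, Pi.single_apply]
    split_ifs <;> omega
  · have : a 0 = b 0 + (Pi.single i (1 : ℤ) : Site 3) 0 := by rw [h, Pi.add_apply]
    rw [Pi.single_apply] at this
    split_ifs at this <;> omega

/-- **An infinite open cluster at `h e₀` reaches the floor inside `ℍ`.**  If `ω` opens only lattice
edges, all shifted half-space clusters of `ω` are finite, and the open cluster of `h e₀` (`h ≥ 0`) is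
infinite, then `h e₀ ↔ c in ℍ` for some floor vertex `c` (`c₀ = 0`): otherwise every open path from
`h e₀` stays at height `≥ 1`, so `C(h e₀) ⊆ C_ℍ(h e₀)`, which is finite. [folklore] -/
theorem exists_wallConn_of_percolatesAt {ω : BondConfig (Site 3)} (hω : ω ⊆ (zdGraph 3).edgeSet)
    (hfin : ∀ v : Site 3, (halfSpaceCluster (𝑻[v] ω)).Finite) (h : ℕ)
    (hinf : ω ∈ percolatesAt (𝐏[h])) :
    ∃ c : Site 3, c 0 = 0 ∧ ω ∈ openConnIn (halfSpace 3) (𝐏[h]) c := by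
  by_contra hno
  push Not at hno
  have hP : (𝐏[h]) ∈ halfSpace 3 := by
    show (0 : ℤ) ≤ (Pi.single 0 (h : ℤ) : Site 3) 0
    simp
  -- every open step from the `ℍ`-cluster of `h e₀` stays in `ℍ`
  have hstep : ∀ {a b : Site 3}, ω ∈ openConnIn (halfSpace 3) (𝐏[h]) a → (openGraph ω).Adj a b →
      ω ∈ openConnIn (halfSpace 3) (𝐏[h]) b := by
    intro a b ha hab
    rw [openGraph_adj] at hab
    have ha0 : 0 ≤ a 0 := ha.2.1
    have ha1 : 1 ≤ a 0 := by
      by_contra hlt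
      exact hno a (by omega) ha
    have hadj : (zdGraph 3).Adj a b := (SimpleGraph.mem_edgeSet _).1 (hω hab.1)
    exact conn_step ha hab.1 hab.2 (neighbour_mem_halfSpace hadj ha1)
  have hwalk : ∀ {a u : Site 3} (q : (openGraph ω).Walk a u),
      ω ∈ openConnIn (halfSpace 3) (𝐏[h]) a → ω ∈ openConnIn (halfSpace 3) (𝐏[h]) u := by
    intro a u q
    induction q with
    | nil => exact id
    | cons hab _ ih => exact fun ha => ih (hstep ha hab)
  have hsub : openCluster ω (𝐏[h]) ⊆ 𝐜𝐥[ω, 𝐏[h]] := by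
    intro u hu
    obtain ⟨q⟩ := (hu : (openGraph ω).Reachable (𝐏[h]) u)
    exact hwalk q (conn_refl ω hP)
  exact (Set.Infinite.mono hsub hinf) (finite_cl_halfSpace hfin hP)

end Deterministic

/-! ## `θ(p_c)` is below the wall-connection probability -/

section Theta

/-- **`θ(p) ≤ P_p(h e₀ ↔ ∂ℍ in ℍ)` for `p ≤ p_c(ℤ³)`**: `θ(p) = P_p(|C(h e₀)| = ∞)` by translation
invariance, and a.s. an infinite cluster at `h e₀` reaches the floor inside `ℍ`
(`exists_wallConn_of_percolatesAt`, all half-space clusters being finite by Barsky–Grimmett–Newman).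
[folklore] -/
theorem theta_le_real_wallConn (p : unitInterval) (hp : p ≤ criticalProbI 3) (h : ℕ) :
    theta (zdGraph 3) (0 : Site 3) p ≤ (bondPercolation (zdGraph 3) p).real
      {ω | ∃ c : Site 3, c 0 = 0 ∧ ω ∈ openConnIn (halfSpace 3) (𝐏[h]) c} := by
  rw [← theta_zdGraph_eq_theta_zero p (𝐏[h])]
  unfold theta
  refine ENNReal.toReal_mono (measure_ne_top _ _) (measure_mono_ae ?_)
  filter_upwards [ae_forall_finite_halfSpaceCluster_shift p hp,
    (ProbabilityTheory.setBernoulli_ae_subset :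
      ∀ᵐ ω ∂bondPercolation (zdGraph 3) p, ω ⊆ (zdGraph 3).edgeSet)] with ω hfin hω hinf
  exact exists_wallConn_of_percolatesAt hω hfin h hinf

/-- **`θ(p) ≤ E_p[N_h(U)/|U ∩ ∂ℍ|]`** for `p ≤ p_c(ℤ³)` and every height `h` (in `ℝ≥0∞`). [folklore] -/
theorem theta_le_lintegral_levelCount (p : unitInterval) (hp : p ≤ criticalProbI 3) (h : ℕ) :
    ENNReal.ofReal (theta (zdGraph 3) (0 : Site 3) p) ≤
      ∫⁻ ω, (((halfSpaceCluster ω ∩ {u : Site 3 | u 0 = (h : ℤ)}).encard : ℕ∞) : ℝ≥0∞) /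
        ((halfSpaceFootprint ω : ℕ∞) : ℝ≥0∞) ∂(bondPercolation (zdGraph 3) p) := by
  rw [← measure_wallConn_eq_lintegral_levelCount p hp h]
  have := theta_le_real_wallConn p hp h
  rw [measureReal_def] at this
  exact (ENNReal.ofReal_le_iff_le_toReal (measure_ne_top _ _)).2 this

/-- **Vanishing level counts kill `θ(p_c)`**: if `E_{p_c}[N_h(U)/|U ∩ ∂ℍ|]` gets below every `ε > 0`
for some height `h`, then `θ(p_c(ℤ³)) = 0`. [folklore] -/
theorem percolationContinuityZ3_of_levelCount_small
    (hK : ∀ ε : ℝ, 0 < ε → ∃ h : ℕ,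
      ∫⁻ ω, (((halfSpaceCluster ω ∩ {u : Site 3 | u 0 = (h : ℤ)}).encard : ℕ∞) : ℝ≥0∞) /
        ((halfSpaceFootprint ω : ℕ∞) : ℝ≥0∞) ∂(bondPercolation (zdGraph 3) (criticalProbI 3)) ≤
          ENNReal.ofReal ε) :
    _root_.PercolationContinuityZ3 := by
  show theta (zdGraph 3) (0 : Site 3) (criticalProbI 3) = 0
  refine le_antisymm (le_of_forall_pos_le_add fun ε hε => ?_) measureReal_nonneg
  rw [zero_add]
  obtain ⟨h, hh⟩ := hK ε hε
  have h1 := (theta_le_lintegral_levelCount (criticalProbI 3) le_rfl h).trans hh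
  exact (ENNReal.ofReal_le_ofReal_iff hε.le).1 h1

end Theta

/-! ## The converse: `{h e₀ ↔ ∂ℍ in ℍ}` is a one-arm event to distance `h` -/

section Converse

/-- For a lattice configuration, `h e₀ ↔ ∂ℍ in ℍ` with `n < h` forces, after moving `h e₀` to the
origin, an open path from `0` to the inner boundary of the box `Λ_n`. [folklore] -/
theorem shift_mem_siteToBoundary_of_wallConn {h n : ℕ} (hn : n < h) {ω : BondConfig (Site 3)}
    (hω' : 𝑻[-𝐏[h]] ω ⊆ (zdGraph 3).edgeSet) {c : Site 3} (hc0 : c 0 = 0)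
    (hc : ω ∈ openConnIn (halfSpace 3) (𝐏[h]) c) :
    𝑻[-𝐏[h]] ω ∈ siteToBoundary 3 n := by
  classical
  -- the shifted configuration joins `0` to `c - h e₀` (inside `ℍ - h e₀`), a point outside `Λ_n`
  have hconn : 𝑻[-𝐏[h]] ω ∈ openConnIn {x : Site 3 | -(h : ℤ) ≤ x 0} 0 (c - 𝐏[h]) := by
    rw [shift_mem_openConnIn_iff_sub (-𝐏[h]) {x : Site 3 | -(h : ℤ) ≤ x 0} ω 0 (c - 𝐏[h]),
      preimage_add_level]
    have hH : {x : Site 3 | -(h : ℤ) - (-𝐏[h]) 0 ≤ x 0} = halfSpace 3 := by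
      rw [BoundaryTwoArmDecay.StubCensus.halfSpace_eq]
      ext x
      simp
    rw [hH]
    simpa only [sub_neg_eq_add, zero_add, sub_add_cancel] using hc
  have hreach : (openGraph (𝑻[-𝐏[h]] ω)).Reachable 0 (c - 𝐏[h]) := conn_reachable hconn
  have hout : c - 𝐏[h] ∉ box 3 n := by
    intro hb
    have := ((mem_box.1 hb) 0).1
    simp only [Pi.sub_apply, hc0, Pi.single_eq_same, zero_sub] at this
    omega
  have hle : openGraph (𝑻[-𝐏[h]] ω) ≤ zdGraph 3 := fun a b hab => by
    rw [openGraph_adj] at hab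
    exact (SimpleGraph.mem_edgeSet _).1 (hω' hab.1)
  obtain ⟨w⟩ := hreach
  have h0 : (0 : Site 3) ∈ box 3 n := by simp [mem_box]
  obtain ⟨b, hb, hu, hb', hr⟩ := exists_innerBoundary_reachable_of_walk hle (box 3 n) w h0 hout
  exact ⟨b, hb, hu, hb', hr⟩

/-- `P_p(h e₀ ↔ ∂ℍ in ℍ) ≤ P_p(0 ↔ ∂Λ_n)` for `n < h` (translation invariance + first exit).
[folklore] -/
theorem real_wallConn_le_real_siteToBoundary (p : unitInterval) {h n : ℕ} (hn : n < h) :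
    (bondPercolation (zdGraph 3) p).real {ω | ∃ c : Site 3, c 0 = 0 ∧
        ω ∈ openConnIn (halfSpace 3) (𝐏[h]) c} ≤
      (bondPercolation (zdGraph 3) p).real (siteToBoundary 3 n) := by
  rw [← bondPercolation_real_preimage_shift (-𝐏[h]) p (siteToBoundary 3 n)]
  refine ENNReal.toReal_mono (measure_ne_top _ _) (measure_mono_ae ?_)
  have hlat : ∀ᵐ ω ∂bondPercolation (zdGraph 3) p, 𝑻[-𝐏[h]] ω ⊆ (zdGraph 3).edgeSet := by
    have h1 : ∀ᵐ ω ∂bondPercolation (zdGraph 3) p, ω ⊆ (zdGraph 3).edgeSet :=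
      ProbabilityTheory.setBernoulli_ae_subset
    rw [← bondPercolation_map_shift (-𝐏[h]) p] at h1
    exact ae_of_ae_map (BondConfig.relabel (sym2Equiv (Site.shift (-𝐏[h])))).measurable.aemeasurable h1
  filter_upwards [hlat] with ω hω' hω
  obtain ⟨c, hc0, hc⟩ := hω
  exact shift_mem_siteToBoundary_of_wallConn hn hω' hc0 hc

/-- **Converse**: if `θ(p_c(ℤ³)) = 0` then `P_{p_c}(h e₀ ↔ ∂ℍ in ℍ) → 0` as `h → ∞` (the one-arm
probabilities `P_{p_c}(0 ↔ ∂Λ_n)` get below every `ε`, `exists_real_siteToBoundary_lt`). [folklore] -/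
theorem tendsto_real_wallConn_of_percolationContinuityZ3 (hθ : _root_.PercolationContinuityZ3) :
    Tendsto (fun h : ℕ => (bondPercolation (zdGraph 3) (criticalProbI 3)).real
      {ω | ∃ c : Site 3, c 0 = 0 ∧ ω ∈ openConnIn (halfSpace 3) (𝐏[h]) c}) atTop (𝓝 0) := by
  have hθ' : theta (zdGraph 3) (0 : Site 3) (criticalProbI 3) = 0 := hθ
  rw [Metric.tendsto_nhds]
  intro ε hε
  obtain ⟨n, hn⟩ := Literature.Probability.Percolation.exists_real_siteToBoundary_lt
    (criticalProbI 3) hθ' hε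
  refine Filter.eventually_atTop.2 ⟨n + 1, fun h hh => ?_⟩
  rw [Real.dist_eq, sub_zero, abs_of_nonneg measureReal_nonneg]
  exact (real_wallConn_le_real_siteToBoundary (criticalProbI 3) (show n < h by omega)).trans_lt hn

/-- The converse for the level counts: `θ(p_c(ℤ³)) = 0 ⟹ E_{p_c}[N_h(U)/|U ∩ ∂ℍ|] → 0`. [folklore] -/
theorem tendsto_lintegral_levelCount_of_percolationContinuityZ3 (hθ : _root_.PercolationContinuityZ3) :
    Tendsto (fun h : ℕ => ∫⁻ ω,
      (((halfSpaceCluster ω ∩ {u : Site 3 | u 0 = (h : ℤ)}).encard : ℕ∞) : ℝ≥0∞) /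
        ((halfSpaceFootprint ω : ℕ∞) : ℝ≥0∞) ∂(bondPercolation (zdGraph 3) (criticalProbI 3)))
      atTop (𝓝 0) := by
  have h1 := ENNReal.tendsto_ofReal (tendsto_real_wallConn_of_percolationContinuityZ3 hθ)
  rw [ENNReal.ofReal_zero] at h1
  refine h1.congr fun h => ?_
  rw [ofReal_measureReal (measure_ne_top _ _), measure_wallConn_eq_lintegral_levelCount _ le_rfl h]

end Converse

/-! ## The level-count form of the conjunct and of the crux -/

section LevelForm

/-- **`θ(p_c(ℤ³)) = 0 ⟺ E_{p_c}[N_h(U)/|U ∩ ∂ℍ|] → 0`**: the conjunct is exactly the statement that the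
footprint-normalised level-`h` mass of the (a.s. finite) critical wall cluster of the origin vanishes as
`h → ∞`. [folklore] -/
theorem percolationContinuityZ3_iff_tendsto_levelCount :
    _root_.PercolationContinuityZ3 ↔
      Tendsto (fun h : ℕ => ∫⁻ ω,
        (((halfSpaceCluster ω ∩ {u : Site 3 | u 0 = (h : ℤ)}).encard : ℕ∞) : ℝ≥0∞) /
          ((halfSpaceFootprint ω : ℕ∞) : ℝ≥0∞) ∂(bondPercolation (zdGraph 3) (criticalProbI 3)))
        atTop (𝓝 0) := by
  refine ⟨tendsto_lintegral_levelCount_of_percolationContinuityZ3, fun hT => ?_⟩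
  refine percolationContinuityZ3_of_levelCount_small fun ε hε => ?_
  have hev := (ENNReal.tendsto_atTop_zero.1 hT) (ENNReal.ofReal ε) (ENNReal.ofReal_pos.2 hε)
  obtain ⟨N, hN⟩ := hev
  exact ⟨N, hN N le_rfl⟩

/-- `θ(p_c(ℤ³)) = 0` gives the axis conclusion of K: `P_{p_c}(0 ↔ n e₀) → 0`. [folklore] -/
theorem tendsto_real_openConn_axis_of_percolationContinuityZ3 (hθ : _root_.PercolationContinuityZ3) :
    Tendsto (fun n : ℕ => (bondPercolation (zdGraph 3) (criticalProbI 3)).real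
      (openConn (0 : Site 3) (Pi.single 0 (n : ℤ) : Site 3))) atTop (𝓝 0) := by
  have hτ : Tendsto (tau 3 (criticalProbI 3) 0) cofinite (𝓝 0) :=
    Literature.Probability.Percolation.tendsto_tau_cofinite_of_theta_eq_zero (criticalProbI 3) hθ
  have hinj : Function.Injective (fun n : ℕ => (Pi.single 0 (n : ℤ) : Site 3)) := by
    intro m n hmn
    have h := congrFun hmn 0
    simp only [Pi.single_eq_same, Nat.cast_inj] at h
    exact h
  have h1 := hτ.comp hinj.tendsto_cofinite
  rw [Nat.cofinite_eq_atTop] at h1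
  exact h1

/-- **The level-count form of the crux.**  `LowPointBookkeeping` (K := A → B → C → axis decay) is
EQUIVALENT to "A → B → C → `E_{p_c}[N_h(U)/|U ∩ ∂ℍ|] → 0`": what A, B, C have to deliver is the decay of
the footprint-normalised level-`h` mass of the wall cluster `U = C_ℍ(0)`. [folklore] -/
theorem lowPointBookkeeping_iff_levelCount :
    Theses.PercLowPointHalfSpace.LowPointBookkeeping ↔
      (Theses.PercLowPointHalfSpace.BoundaryTwoArmDecay →
        Theses.PercLowPointHalfSpace.TallClusterMassBound →
          Theses.PercLowPointHalfSpace.QuantitativeBGN →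
            Tendsto (fun h : ℕ => ∫⁻ ω,
              (((halfSpaceCluster ω ∩ {u : Site 3 | u 0 = (h : ℤ)}).encard : ℕ∞) : ℝ≥0∞) /
                ((halfSpaceFootprint ω : ℕ∞) : ℝ≥0∞) ∂(bondPercolation (zdGraph 3) (criticalProbI 3)))
              atTop (𝓝 0)) := by
  constructor
  · intro hK hA hB hC
    exact tendsto_lintegral_levelCount_of_percolationContinuityZ3
      (percolationContinuityZ3_of_tendsto_openConn _ (hK hA hB hC))
  · intro hL hA hB hC
    exact tendsto_real_openConn_axis_of_percolationContinuityZ3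
      (percolationContinuityZ3_iff_tendsto_levelCount.2 (hL hA hB hC))

/-- **K from level-count decay** (the sufficient direction, hypotheses A, B, C idle). [folklore] -/
theorem lowPointBookkeeping_of_tendsto_levelCount
    (hL : Tendsto (fun h : ℕ => ∫⁻ ω,
      (((halfSpaceCluster ω ∩ {u : Site 3 | u 0 = (h : ℤ)}).encard : ℕ∞) : ℝ≥0∞) /
        ((halfSpaceFootprint ω : ℕ∞) : ℝ≥0∞) ∂(bondPercolation (zdGraph 3) (criticalProbI 3)))
      atTop (𝓝 0)) :
    Theses.PercLowPointHalfSpace.LowPointBookkeeping :=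
  lowPointBookkeeping_iff_levelCount.2 fun _ _ _ => hL

end LevelForm

/-! ## Registered form -/

/-- **Registered stub `stub_levelCountForm`** (crux stmt-CriticalPhenomena-14713): the level-count form of
the crux, verbatim the registered signature. [folklore] -/
theorem stub_levelCountForm : LowPointBookkeeping ↔ (BoundaryTwoArmDecay → TallClusterMassBound → QuantitativeBGN → Filter.Tendsto (fun h : ℕ => ∫⁻ ω, (((halfSpaceCluster ω ∩ {u : Site 3 | u 0 = (h : ℤ)}).encard : ℕ∞) : ENNReal) / ((halfSpaceFootprint ω : ℕ∞) : ENNReal) ∂(bondPercolation (zdGraph 3) (criticalProbI 3))) Filter.atTop (nhds 0)) :=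
  lowPointBookkeeping_iff_levelCount

end LowPoint

end Summit.CriticalPhenomena.PercolationContinuityZ3.Theorems

end
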